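import Summits.Ventures.YMGap.FlowData.RectTubeMagneticTwistFlatness
import Summits.Ventures.LatticeQCDFlow.Scoring.SU2CharacterExpansion
import HarnessLib

/-!
# Venture YMGap, track Y3 FLOW-DATA — Haar moments of the temporal plaquette sum `elec(a, E, b)` of the rectangular tube:
# it integrates to ZERO in the later and in the earlier slice separately when `ρ` has no invariant vector (theorems only)

HONEST FRAMING: venture file of the cell `pub-ymgap` (QuantumFields programme), track Y3 (FLOW-DATA); companion THEOREMS for
`FlowData/RectTubeMagneticTwistFlatness.lean` (`rectElecSum`, `RectSlice`).  Finite rectangular tube `Π ℤ/Lᵢ`, compact `G` with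
probability Haar measure, continuous `ρ`.  When `∫ Re tr ρ(C g D) dg = 0` for all `C, D` (no invariant vector — e.g. the `SU(2)`
fundamental, `su2_integral_re_trace_mul_mul_eq_zero`):

* `integral_rectSlice_apply_eq` — integrating a function of ONE link of a slice;
* `integral_rectElecSum_later_eq_zero` / `integral_rectElecSum_earlier_eq_zero` — `∫_b elec(a,E,b) db = 0 = ∫_a elec(a,E,b) da`;
  iterated forms `integral_integral_rectElecSum_later_eq_zero`, `integral_integral_mul_rectElecSum_earlier_eq_zero`;
* continuity / measurability bookkeeping (`continuous_rectElecSum_links`, `continuous_triple_later/earlier/pair`,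
  `measurable_curry_of_uncurry`, `continuous_rectElecSum_later_links`, `continuous_rectElecSum_earlier_links`).

Used by the second-order strong-coupling law of `E_mag` (`FlowData/RectTubeStepExponentMoments.lean`,
`FlowData/RectTubeMagneticSecondOrderLaw.lean`).  Nothing about `L → ∞`, the continuum or a mass gap; no FLOW-TABLE number.

References: I. Montvay, G. Münster (1994) §3.2.6 [cite: MontvayMunster1994, §3.2.6]; M. Creutz (1983) ch. 8 [cite: Creutz1983, ch. 8].
-/

noncomputable section

open scoped BigOperators ENNReal InnerProductSpace
open MeasureTheory Filter Function Topology
open Literature.MathematicalPhysics.QuantumFieldTheory Literature.Analysis.OperatorTheory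
open Literature.MathematicalPhysics.QuantumLattice (RectTorusSite fundamentalRep continuous_fundamentalRep
  fundamentalRep_mem_unitaryGroup)
open Literature.Barriers.QuantumFields
open Summit.Ventures.YMGap.Census (RectPlaquette)

namespace Summit.Ventures.YMGap.FlowData

section Moments

variable {G : Type*} [Group G] [TopologicalSpace G] [IsTopologicalGroup G] [CompactSpace G]
  [MeasurableSpace G] [BorelSpace G] [SecondCountableTopology G] {n k : ℕ} (ρ : G →* Matrix (Fin n) (Fin n) ℂ)
  (J : ℝ) {Ls : Fin k → ℕ} [∀ i, NeZero (Ls i)]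

omit [SecondCountableTopology G] in
/-- Integrating a function of ONE link over the slice measure is the Haar integral of that function. [folklore] -/
theorem integral_rectSlice_apply_eq (e : RectTorusSite Ls × Fin k) {f : G → ℝ} (hf : Measurable f) :
    ∫ a, f (a e) ∂(rectSliceMeasure G Ls) = ∫ g, f g ∂(haarProbability G) := by
  have hmp := MeasureTheory.measurePreserving_eval (fun _ : RectTorusSite Ls × Fin k => haarProbability G) e
  rw [← hmp.map_eq, integral_map (measurable_pi_apply e).aemeasurable hf.aestronglyMeasurable]

/-- **The temporal plaquette sum integrates to zero in the LATER slice** when `ρ` has no invariant vector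
(`∫ Re tr ρ(C g D) dg = 0`): `∫ elec(a, E, b) db = 0`. [folklore] -/
theorem integral_rectElecSum_later_eq_zero (hρ : Continuous ρ)
    (hρ0 : ∀ C D : G, ∫ g, (ρ (C * g * D)).trace.re ∂(haarProbability G) = 0)
    (a : RectSlice Ls G) (E : RectTorusSite Ls → G) :
    ∫ b, rectElecSum ρ a E b ∂(rectSliceMeasure G Ls) = 0 := by
  have htr : Continuous fun g : G => (ρ g).trace.re := Complex.continuous_re.comp (Continuous.matrix_trace hρ)
  -- each temporal plaquette as a continuous function of the later slice
  have hterm : ∀ (x : RectTorusSite Ls) (i : Fin k), Continuous fun b : RectSlice Ls G =>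
      (ρ (E x * b (x, i) * (E (x + Pi.single i 1))⁻¹ * (a (x, i))⁻¹)).trace.re := by
    intro x i
    have h1 : Continuous fun b : RectSlice Ls G => b (x, i) := continuous_apply (x, i)
    exact htr.comp (((continuous_const.mul h1).mul continuous_const).mul continuous_const)
  have hint : ∀ (x : RectTorusSite Ls) (i : Fin k), Integrable (fun b : RectSlice Ls G =>
      (ρ (E x * b (x, i) * (E (x + Pi.single i 1))⁻¹ * (a (x, i))⁻¹)).trace.re) (rectSliceMeasure G Ls) :=
    fun x i => (hterm x i).integrable_of_hasCompactSupport (HasCompactSupport.of_compactSpace _)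
  unfold rectElecSum
  rw [integral_finsetSum _ fun x _ => integrable_finsetSum _ fun i _ => hint x i]
  refine Finset.sum_eq_zero fun x _ => ?_
  rw [integral_finsetSum _ fun i _ => hint x i]
  refine Finset.sum_eq_zero fun i _ => ?_
  have hf : Continuous fun g : G => (ρ (E x * g * (E (x + Pi.single i 1))⁻¹ * (a (x, i))⁻¹)).trace.re := by
    have h1 : Continuous fun g : G => E x * g * (E (x + Pi.single i 1))⁻¹ * (a (x, i))⁻¹ :=
      ((continuous_const.mul continuous_id).mul continuous_const).mul continuous_const
    exact htr.comp h1
  rw [integral_rectSlice_apply_eq (x, i) hf.measurable]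
  have h2 := hρ0 (E x) ((E (x + Pi.single i 1))⁻¹ * (a (x, i))⁻¹)
  simp only [← mul_assoc] at h2
  exact h2

/-- **The temporal plaquette sum integrates to zero in the EARLIER slice** (`∫ Re tr ρ(C g D) dg = 0`, inversion invariance of
Haar measure): `∫ elec(a, E, b) da = 0`. [folklore] -/
theorem integral_rectElecSum_earlier_eq_zero (hρ : Continuous ρ)
    (hρ0 : ∀ C D : G, ∫ g, (ρ (C * g * D)).trace.re ∂(haarProbability G) = 0)
    (E : RectTorusSite Ls → G) (b : RectSlice Ls G) :
    ∫ a, rectElecSum ρ a E b ∂(rectSliceMeasure G Ls) = 0 := by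
  have htr : Continuous fun g : G => (ρ g).trace.re := Complex.continuous_re.comp (Continuous.matrix_trace hρ)
  have hinv : ∀ C : G, ∫ g, (ρ (C * g⁻¹)).trace.re ∂(haarProbability G) = 0 := by
    intro C
    have h := integral_inv_eq_self (fun g : G => (ρ (C * g)).trace.re) (haarProbability G)
    rw [h]
    have h2 := hρ0 C 1
    simp only [mul_one] at h2
    exact h2
  have hterm : ∀ (x : RectTorusSite Ls) (i : Fin k), Continuous fun a : RectSlice Ls G =>
      (ρ (E x * b (x, i) * (E (x + Pi.single i 1))⁻¹ * (a (x, i))⁻¹)).trace.re := by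
    intro x i
    have h1 : Continuous fun a : RectSlice Ls G => a (x, i) := continuous_apply (x, i)
    exact htr.comp (continuous_const.mul h1.inv)
  have hint : ∀ (x : RectTorusSite Ls) (i : Fin k), Integrable (fun a : RectSlice Ls G =>
      (ρ (E x * b (x, i) * (E (x + Pi.single i 1))⁻¹ * (a (x, i))⁻¹)).trace.re) (rectSliceMeasure G Ls) :=
    fun x i => (hterm x i).integrable_of_hasCompactSupport (HasCompactSupport.of_compactSpace _)
  unfold rectElecSum
  rw [integral_finsetSum _ fun x _ => integrable_finsetSum _ fun i _ => hint x i]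
  refine Finset.sum_eq_zero fun x _ => ?_
  rw [integral_finsetSum _ fun i _ => hint x i]
  refine Finset.sum_eq_zero fun i _ => ?_
  have hf : Continuous fun g : G => (ρ (E x * b (x, i) * (E (x + Pi.single i 1))⁻¹ * g⁻¹)).trace.re := by
    have h1 : Continuous fun g : G => E x * b (x, i) * (E (x + Pi.single i 1))⁻¹ * g⁻¹ :=
      continuous_const.mul continuous_id.inv
    exact htr.comp h1
  rw [integral_rectSlice_apply_eq (x, i) hf.measurable]
  exact hinv _

omit [CompactSpace G] [MeasurableSpace G] [BorelSpace G] [SecondCountableTopology G] in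
/-- Continuity of `elec` in the temporal links alone. [folklore] -/
theorem continuous_rectElecSum_links (hρ : Continuous ρ) (a b : RectSlice Ls G) :
    Continuous fun E : RectTorusSite Ls → G => rectElecSum ρ a E b := by
  have htr : Continuous fun g : G => (ρ g).trace.re := Complex.continuous_re.comp (Continuous.matrix_trace hρ)
  unfold rectElecSum
  refine continuous_finsetSum _ fun x _ => continuous_finsetSum _ fun i _ => ?_
  have h1 : Continuous fun E : RectTorusSite Ls → G => E x := continuous_apply x
  have h2 : Continuous fun E : RectTorusSite Ls → G => E (x + Pi.single i 1) := continuous_apply _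
  exact htr.comp (((h1.mul continuous_const).mul h2.inv).mul continuous_const)

/-- Freezing the earlier argument of a jointly continuous triple function (stated for an ABSTRACT `q` so that the
instantiation `q := rectElecSum ρ` is syntactic). [folklore] -/
theorem continuous_triple_later {X Y : Type*} [TopologicalSpace X] [TopologicalSpace Y] (q : X → Y → X → ℝ)
    (hq : Continuous fun z : (X × X) × Y => q z.1.1 z.2 z.1.2) (a : X) :
    Continuous fun z : X × Y => q a z.2 z.1 :=
  hq.comp ((continuous_const.prodMk continuous_fst).prodMk continuous_snd)

/-- Freezing the later argument of a jointly continuous triple function. [folklore] -/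
theorem continuous_triple_earlier {X Y : Type*} [TopologicalSpace X] [TopologicalSpace Y] (q : X → Y → X → ℝ)
    (hq : Continuous fun z : (X × X) × Y => q z.1.1 z.2 z.1.2) (b : X) :
    Continuous fun z : X × Y => q z.1 z.2 b :=
  hq.comp ((continuous_fst.prodMk continuous_const).prodMk continuous_snd)

/-- Freezing the middle argument of a jointly continuous triple function. [folklore] -/
theorem continuous_triple_pair {X Y : Type*} [TopologicalSpace X] [TopologicalSpace Y] (q : X → Y → X → ℝ)
    (hq : Continuous fun z : (X × X) × Y => q z.1.1 z.2 z.1.2) :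
    Continuous fun z : X × (X × Y) => q z.1 z.2.2 z.2.1 :=
  hq.comp ((continuous_fst.prodMk (continuous_fst.comp continuous_snd)).prodMk (continuous_snd.comp continuous_snd))

/-- Freezing the first argument of a jointly measurable function of two variables (abstract `F`). [folklore] -/
theorem measurable_curry_of_uncurry {X : Type*} [MeasurableSpace X] (F : X → X → ℝ) (hF : StronglyMeasurable (uncurry F))
    (a : X) : Measurable fun b => F a b :=
  hF.measurable.comp (measurable_const.prodMk measurable_id)

omit [CompactSpace G] [MeasurableSpace G] [BorelSpace G] [SecondCountableTopology G] in
/-- Continuity of `elec` in (later slice, temporal links) jointly. [folklore] -/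
theorem continuous_rectElecSum_later_links (hρ : Continuous ρ) (a : RectSlice Ls G) :
    Continuous fun z : RectSlice Ls G × (RectTorusSite Ls → G) => rectElecSum ρ a z.2 z.1 :=
  continuous_triple_later (rectElecSum (Ls := Ls) ρ) (continuous_rectElecSum ρ hρ) a

omit [CompactSpace G] [MeasurableSpace G] [BorelSpace G] [SecondCountableTopology G] in
/-- Continuity of `elec` in (earlier slice, temporal links) jointly. [folklore] -/
theorem continuous_rectElecSum_earlier_links (hρ : Continuous ρ) (b : RectSlice Ls G) :
    Continuous fun z : RectSlice Ls G × (RectTorusSite Ls → G) => rectElecSum ρ z.1 z.2 b :=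
  continuous_triple_earlier (rectElecSum (Ls := Ls) ρ) (continuous_rectElecSum ρ hρ) b

/-- `∫_b ∫_E elec(a,E,b) = 0`. [folklore] -/
theorem integral_integral_rectElecSum_later_eq_zero (hρ : Continuous ρ)
    (hρ0 : ∀ C D : G, ∫ g, (ρ (C * g * D)).trace.re ∂(haarProbability G) = 0) (a : RectSlice Ls G) :
    ∫ b, ∫ E, rectElecSum ρ a E b ∂(Measure.pi fun _ : RectTorusSite Ls => haarProbability G)
      ∂(rectSliceMeasure G Ls) = 0 := by
  have hc := continuous_rectElecSum_later_links ρ (Ls := Ls) hρ a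
  rw [integral_integral_swap (hc.integrable_of_hasCompactSupport (HasCompactSupport.of_compactSpace _))]
  simp_rw [integral_rectElecSum_later_eq_zero ρ hρ hρ0]
  rw [integral_zero]

/-- `∫_a ∫_E f(E) · elec(a,E,b) = 0` for a continuous weight `f` of the temporal links (the earlier slice integrates `elec` away).
[folklore] -/
theorem integral_integral_mul_rectElecSum_earlier_eq_zero (hρ : Continuous ρ)
    (hρ0 : ∀ C D : G, ∫ g, (ρ (C * g * D)).trace.re ∂(haarProbability G) = 0) (b : RectSlice Ls G)
    {f : (RectTorusSite Ls → G) → ℝ} (hf : Continuous f) :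
    ∫ a, ∫ E, f E * rectElecSum ρ a E b ∂(Measure.pi fun _ : RectTorusSite Ls => haarProbability G)
      ∂(rectSliceMeasure G Ls) = 0 := by
  have hc : Continuous fun z : RectSlice Ls G × (RectTorusSite Ls → G) => f z.2 * rectElecSum ρ z.1 z.2 b :=
    (hf.comp continuous_snd).mul (continuous_rectElecSum_earlier_links ρ (Ls := Ls) hρ b)
  rw [integral_integral_swap (hc.integrable_of_hasCompactSupport (HasCompactSupport.of_compactSpace _))]
  simp_rw [integral_const_mul, integral_rectElecSum_earlier_eq_zero ρ hρ hρ0, mul_zero]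
  rw [integral_zero]

end Moments

/-! ### The cell's objects: `SU(2)`, fundamental representation -/

section SU2

variable {k : ℕ} {Ls : Fin k → ℕ} [∀ i, NeZero (Ls i)]

/-- **The fundamental representation of `SU(2)` has no invariant vector**: `∫ Re tr(C g D) dg = 0` for all `C, D`
(left/right invariance of Haar measure and `∫ χ₁ = 0`). [folklore] -/
theorem su2_integral_re_trace_mul_mul_eq_zero (C D : Matrix.specialUnitaryGroup (Fin 2) ℂ) :
    ∫ g, ((fundamentalRep (Fin 2) (C * g * D)).trace).re ∂haarProbability (Matrix.specialUnitaryGroup (Fin 2) ℂ) = 0 := by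
  have h1 := integral_mul_left_eq_self (μ := haarProbability (Matrix.specialUnitaryGroup (Fin 2) ℂ))
    (fun g : Matrix.specialUnitaryGroup (Fin 2) ℂ => ((fundamentalRep (Fin 2) (g * D)).trace).re) C
  rw [h1]
  have h2 := integral_mul_right_eq_self (μ := haarProbability (Matrix.specialUnitaryGroup (Fin 2) ℂ))
    (fun g : Matrix.specialUnitaryGroup (Fin 2) ℂ => ((fundamentalRep (Fin 2) g).trace).re) D
  rw [h2]
  have hU1 : ∀ x : ℝ, (Polynomial.Chebyshev.U ℝ 1).eval x = 2 * x := fun x => by simp [Polynomial.Chebyshev.U_one]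
  have h3 := Summit.Ventures.LatticeQCDFlow.Scoring.integral_su2Character_eq_zero (n := 1) one_ne_zero
  simp only [Nat.cast_one, hU1] at h3
  simp_rw [Summit.Ventures.LatticeQCDFlow.Scoring.fundamentalRep_trace_re]
  exact h3

end SU2

end Summit.Ventures.YMGap.FlowData
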